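import Summits.PneNP.PneNP.Theorems.ChebyshevTracialDesignTightColumnSums
import Summits.PneNP.PneNP.Theorems.ChebyshevTracialDesignVirtualKernel
import HarnessLib

/-!
# Cell pnp-psdrank, route `ChebyshevTracialDesign`: Grigoriev's VIRTUAL functional on a Johnson layer in closed form —
# `Ẽ_M[ζp] = V_κ · Π_p(M)` with `V_κ` an explicit product

Harmonic backbone of the crux `TracialDecayExp20` (stmt-PneNP-19878), brick 44a (prover g10; MEMO-12 §3 «next prover (0)», the first
input of NTF mod KL). Let `M` be a perfect matching of `K_n` (partner map `π`), `p` a Johnson-harmonic coefficient vector of degree `k`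
(lit `JohnsonHarmonics.IsHarmonic`), `x_M(A) = #{e ∈ M : e ∩ A ≠ ∅}` the number of matching edges met by `A`, and
`K(x) = knapsackMoment N r x = Π_{j<x} (r − j)/(N − j)` Grigoriev's knapsack pseudo-moments [cite: Grigoriev2001, Lemma 1.4 (PDF p. 8)];
the tree's virtual level is `Ẽ_M[ζ_A] = K(x_M(A))` with `N = |M| = n/2`, `r = t/2` (bricks G/14/19: `…LowDegreePricing`,
`…ProfileExtrapolation`; eng `…VirtualKernel`). MAIN STATEMENTS:
* §1 `two_mul_card_meet_add` — `2·x_M(A) + d_M(A) = 2|A|`, `d_M(A) = #{x ∈ A : π x ∈ A}`;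
* §2 `virtualSum_eq_zero_of_odd`, **`virtualSum_eq_of_even`** — `Σ_A p_A K(x_M(A)) = 0` for odd `k`, and for `k = 2κ`
  `Σ_A p_A K(x_M(A)) = (Σ_{s≤κ} (−1)^{κ−s} C(κ,s) K(2κ−s)) · Π_p(M)`, `Π_p(M) = Σ_{T : d_M(T) = 2κ} p_T` the closed-pair functional of
  bricks 3/5b/26 — from the pairing identities `Q_{2s} = (−1)^{κ−s} C(κ,s) Q_{2κ}` (`…MatchingHarmonics.pairedSum_eq_of_even`): the virtual
  functional, like every level functional, sees an even layer only through `Π_p` (MEMO-7 (★) at the VIRTUAL level);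
* §3 `fwdDiff_iter_knapsackMoment`, **`altSum_knapsackMoment_eq`** — the difference calculus of the knapsack moments:
  `(Δ^j K)(x)·Π_{i<j}(N − x − i) = K(x)·Π_{i<j} (r − N + i)`, hence (Chu–Vandermonde) the virtual scalar is the PRODUCT
  `V_κ = Π_{i<κ} (r−i)/(N−i) · Π_{i<κ} (N−r−i)/(N−κ−i)`; at `N = n/2`, `r = t/2`, `t = 2a+1`:
  `V_κ = Π_{i<κ} (2a+1−2i)/(n−2i) · Π_{i<κ} (n−2a−1−2i)/(n−2κ−2i)` (`virtualScalar_eq_prod`).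
The comparison with the TIGHT functional (ratio `1 + ρ_{2κ}`) is the companion file `…VirtualLayerRatio`.
[cite: Grigoriev2001, Lemma 1.4 (PDF p. 8)] [cite: Rothvoss2017, §2 (PDF p. 6)] [cite: GodsilMeagher2015, §15.2 (perfect matching scheme)]
Stature: support/instrument (no defs). WHAT THIS IS NOT: not virtual nonnegativity, nothing on psd rank, no P-vs-NP content. Supports stmt-PneNP-19878.
-/

set_option linter.dupNamespace false -- `Summit.PneNP.PneNP.…`: summit = sub-problem (D-0017)

noncomputable section

namespace Summit.PneNP.PneNP.Theorems.ChebyshevTracialDesignVirtualLayerFunctional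

open Finset Literature.Barriers.PneNP Literature.Computability.Complexity
open Literature.Combinatorics.SimpleGraph.CycleSpace
open Literature.Combinatorics.AssociationSchemes Literature.Combinatorics.AssociationSchemes.JohnsonHarmonics
open Summit.PneNP.PneNP.Theorems.ChebyshevTracialDesignMatchingHarmonics
open Summit.PneNP.PneNP.Theorems.ChebyshevTracialDesignTightColumnSums
open Summit.PneNP.PneNP.Theorems.ChebyshevTracialDesignVirtualKernel
open Summit.PneNP.PneNP.Theorems.ChebyshevTracialDesignJunta (crosses_iff_cutCount_eq_one two_mul_card_eq)
open scoped fwdDiff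

variable {n : ℕ}

/-! ### §1 Edges met versus internally paired points -/

/-- The crossing edges of `A` correspond to the points of `A` whose partner lies outside `A`. [folklore] -/
theorem card_filter_cutCount_eq_one (M : PMatch n) (A : Finset (Fin n)) :
    (M.1.filter fun e => cutCount A e = 1).card = (A.filter fun x => M.2.partner x ∉ A).card := by
  classical
  have hset : (M.1.filter fun e => cutCount A e = 1) = M.1.filter (Crosses A) :=
    filter_congr fun e _ => (crosses_iff_cutCount_eq_one A e).symm
  rw [hset]
  symm
  refine card_bij (fun x _ => s(x, M.2.partner x)) ?_ ?_ ?_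
  · intro x hx
    rw [mem_filter] at hx ⊢
    exact ⟨M.2.mk_partner_mem x, (crosses_mk A _ _).2 (Or.inl ⟨hx.1, hx.2⟩)⟩
  · intro x hx y hy hxy
    rw [mem_filter] at hx hy
    rcases Sym2.eq_iff.1 hxy with ⟨h, -⟩ | ⟨h1, h2⟩
    · exact h
    · exact absurd hy.1 (h2 ▸ hx.2)
  · intro e he
    rw [mem_filter] at he
    obtain ⟨a, b, rfl, ha, hb⟩ := crosses_iff_exists.1 he.2
    refine ⟨a, mem_filter.2 ⟨ha, ?_⟩, ?_⟩
    · rw [← M.2.eq_partner_of_mem he.1]; exact hb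
    · rw [← M.2.eq_partner_of_mem he.1]

/-- **`2·x_M(A) + d_M(A) = 2|A|`**: twice the number of matching edges met by `A` plus the number of internally paired points of `A`
is `2|A|` (met edges = crossing + internal, `|A|` = crossing + 2·internal, internally paired points = `|A|` − crossing). [folklore] -/
theorem two_mul_card_meet_add (M : PMatch n) (A : Finset (Fin n)) :
    2 * (M.1.filter fun e => ∃ a ∈ A, a ∈ e).card + (A.filter fun x => M.2.partner x ∈ A).card = 2 * A.card := by
  classical
  obtain ⟨hmeet, hcard⟩ := card_meet_eq_cr_add_in M.2 (subset_univ A)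
  have hmeet' : (M.1.filter fun e => ∃ a ∈ A, a ∈ e).card =
      (M.1.filter fun e => cutCount A e = 1).card + (M.1.filter fun e => cutCount A e = 2).card := by
    convert hmeet using 3
  have hcr := card_filter_cutCount_eq_one M A
  have hsplit := card_filter_add_card_filter_not (s := A) (fun x => M.2.partner x ∈ A)
  omega

/-! ### §2 The virtual functional on a harmonic layer: odd layers vanish, even layers give `V_κ · Π_p(M)` -/

/-- **Odd layers are invisible to the virtual functional**: for a harmonic `p` of odd degree `k`, every perfect matching `M` and all
`N, r`: `Σ_A p_A · knapsackMoment N r (x_M(A)) = 0`. [cite: Grigoriev2001, Lemma 1.4 (PDF p. 8)] -/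
theorem virtualSum_eq_zero_of_odd (M : PMatch n) {k : ℕ} (hk : Odd k) {p : Finset (Fin n) → ℝ} (hp : IsHarmonic k p)
    (N : ℕ) (r : ℝ) :
    ∑ A : Finset (Fin n), p A * knapsackMoment N r (M.1.filter fun e => ∃ a ∈ A, a ∈ e).card = 0 := by
  classical
  obtain ⟨hinv, hfix⟩ := partner_invol M
  -- on the support the moment depends on `A` only through the class `d_M(A)`
  let G : ℕ → ℝ := fun d => knapsackMoment N r (k - d / 2)
  have hterm : ∀ A : Finset (Fin n), p A * knapsackMoment N r (M.1.filter fun e => ∃ a ∈ A, a ∈ e).card =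
      p A * G (A.filter fun x => M.2.partner x ∈ A).card := by
    intro A
    by_cases hA : A.card = k
    · have h := two_mul_card_meet_add M A
      have hx : k - (A.filter fun x => M.2.partner x ∈ A).card / 2 = (M.1.filter fun e => ∃ a ∈ A, a ∈ e).card := by omega
      simp only [G, hx]
    · rw [hp.1 A hA, zero_mul, zero_mul]
  rw [sum_congr rfl fun A _ => hterm A]
  have hsplit : ∑ A : Finset (Fin n), p A * G (A.filter fun x => M.2.partner x ∈ A).card =
      ∑ d ∈ range (n + 1), ∑ A ∈ univ.filter (fun A : Finset (Fin n) => (A.filter fun x => M.2.partner x ∈ A).card = d),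
        p A * G (A.filter fun x => M.2.partner x ∈ A).card := by
    rw [← sum_biUnion]
    · refine (sum_subset (subset_univ _) fun A _ hA => ?_).symm
      exfalso; apply hA
      rw [mem_biUnion]
      refine ⟨(A.filter fun x => M.2.partner x ∈ A).card, mem_range.2 ?_, by simp⟩
      have := (card_filter_le A (fun x => M.2.partner x ∈ A)).trans (card_finset_fin_le A)
      omega
    · intro i _ j _ hij
      exact disjoint_filter.2 fun A _ h1 h2 => hij (h1.symm.trans h2)
  rw [hsplit]
  refine sum_eq_zero fun d _ => ?_
  have hcl : ∑ A ∈ univ.filter (fun A : Finset (Fin n) => (A.filter fun x => M.2.partner x ∈ A).card = d),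
      p A * G (A.filter fun x => M.2.partner x ∈ A).card =
      G d * ∑ A ∈ univ.filter (fun A : Finset (Fin n) => (A.filter fun x => M.2.partner x ∈ A).card = d), p A := by
    rw [mul_sum]
    refine sum_congr rfl fun A hA => ?_
    simp only [mem_filter, mem_univ, true_and] at hA
    rw [hA, mul_comm]
  rw [hcl, pairedSum_eq_zero_of_odd hinv hfix hk hp d, mul_zero]

/-- **Even layers: the virtual functional factors through the closed-pair functional.** For a harmonic `p` of degree `2κ`,
every perfect matching `M` of `K_n` and all `N, r`:
`Σ_A p_A · knapsackMoment N r (x_M(A)) = (Σ_{s ≤ κ} (−1)^{κ−s} C(κ,s) · knapsackMoment N r (2κ − s)) · Σ_{T : d_M(T) = 2κ} p_T`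
(an `A` of the class `d_M(A) = 2s` meets `2κ − s` edges; pairing identities `Q_{2s} = (−1)^{κ−s} C(κ,s) Q_{2κ}`).
[cite: Grigoriev2001, Lemma 1.4 (PDF p. 8)] [cite: GodsilMeagher2015, §15.2] -/
theorem virtualSum_eq_of_even (M : PMatch n) {κ : ℕ} (hκn : 2 * κ ≤ n) {p : Finset (Fin n) → ℝ} (hp : IsHarmonic (2 * κ) p)
    (N : ℕ) (r : ℝ) :
    ∑ A : Finset (Fin n), p A * knapsackMoment N r (M.1.filter fun e => ∃ a ∈ A, a ∈ e).card =
      (∑ s ∈ range (κ + 1), (-1 : ℝ) ^ (κ - s) * (κ.choose s : ℝ) * knapsackMoment N r (2 * κ - s)) *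
        ∑ T ∈ univ.filter (fun T : Finset (Fin n) => (T.filter fun x => M.2.partner x ∈ T).card = 2 * κ), p T := by
  classical
  obtain ⟨hinv, hfix⟩ := partner_invol M
  let G : ℕ → ℝ := fun d => knapsackMoment N r (2 * κ - d / 2)
  have hterm : ∀ A : Finset (Fin n), p A * knapsackMoment N r (M.1.filter fun e => ∃ a ∈ A, a ∈ e).card =
      p A * G (A.filter fun x => M.2.partner x ∈ A).card := by
    intro A
    by_cases hA : A.card = 2 * κ
    · have h := two_mul_card_meet_add M A
      have hx : 2 * κ - (A.filter fun x => M.2.partner x ∈ A).card / 2 = (M.1.filter fun e => ∃ a ∈ A, a ∈ e).card := by omega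
      simp only [G, hx]
    · rw [hp.1 A hA, zero_mul, zero_mul]
  rw [sum_congr rfl fun A _ => hterm A]
  have hsplit : ∑ A : Finset (Fin n), p A * G (A.filter fun x => M.2.partner x ∈ A).card =
      ∑ d ∈ range (n + 1), ∑ A ∈ univ.filter (fun A : Finset (Fin n) => (A.filter fun x => M.2.partner x ∈ A).card = d),
        p A * G (A.filter fun x => M.2.partner x ∈ A).card := by
    rw [← sum_biUnion]
    · refine (sum_subset (subset_univ _) fun A _ hA => ?_).symm
      exfalso; apply hA
      rw [mem_biUnion]
      refine ⟨(A.filter fun x => M.2.partner x ∈ A).card, mem_range.2 ?_, by simp⟩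
      have := (card_filter_le A (fun x => M.2.partner x ∈ A)).trans (card_finset_fin_le A)
      omega
    · intro i _ j _ hij
      exact disjoint_filter.2 fun A _ h1 h2 => hij (h1.symm.trans h2)
  rw [hsplit]
  have hcl : ∀ d, ∑ A ∈ univ.filter (fun A : Finset (Fin n) => (A.filter fun x => M.2.partner x ∈ A).card = d),
      p A * G (A.filter fun x => M.2.partner x ∈ A).card =
      G d * ∑ A ∈ univ.filter (fun A : Finset (Fin n) => (A.filter fun x => M.2.partner x ∈ A).card = d), p A := by
    intro d
    rw [mul_sum]
    refine sum_congr rfl fun A hA => ?_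
    simp only [mem_filter, mem_univ, true_and] at hA
    rw [hA, mul_comm]
  simp only [hcl]
  -- odd classes and classes above `k` vanish
  have hodd_empty : ∀ d, ¬ 2 ∣ d →
      ∑ A ∈ univ.filter (fun A : Finset (Fin n) => (A.filter fun x => M.2.partner x ∈ A).card = d), p A = 0 := by
    intro d hd
    refine sum_eq_zero fun A hA => ?_
    simp only [mem_filter, mem_univ, true_and] at hA
    by_cases hAk : A.card = 2 * κ
    · exfalso
      have h := two_mul_card_meet_add M A
      rw [hA, hAk] at h
      omega
    · exact hp.1 A hAk
  have hbig : ∀ d, 2 * κ < d →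
      ∑ A ∈ univ.filter (fun A : Finset (Fin n) => (A.filter fun x => M.2.partner x ∈ A).card = d), p A = 0 := by
    intro d hd
    refine sum_eq_zero fun A hA => ?_
    simp only [mem_filter, mem_univ, true_and] at hA
    by_cases hAk : A.card = 2 * κ
    · exfalso
      have := card_filter_le A (fun x => M.2.partner x ∈ A)
      rw [hA, hAk] at this
      omega
    · exact hp.1 A hAk
  have hreindex : ∑ d ∈ range (n + 1),
      G d * ∑ A ∈ univ.filter (fun A : Finset (Fin n) => (A.filter fun x => M.2.partner x ∈ A).card = d), p A =
      ∑ s ∈ range (κ + 1),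
        G (2 * s) * ∑ A ∈ univ.filter (fun A : Finset (Fin n) => (A.filter fun x => M.2.partner x ∈ A).card = 2 * s), p A := by
    symm
    refine sum_of_injOn (fun s => 2 * s) (fun s _ t _ h => by simpa using h) ?_ ?_ (fun s _ => rfl)
    · intro s hs
      simp only [coe_range, Set.mem_Iio] at hs ⊢
      omega
    · intro d hd hnot
      simp only [Set.mem_image, coe_range, Set.mem_Iio, not_exists, not_and] at hnot
      by_cases h2 : 2 ∣ d
      · obtain ⟨s, rfl⟩ := h2
        have hs : κ < s := by
          by_contra hle
          exact hnot s (by push Not at hle; omega) rfl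
        rw [hbig (2 * s) (by omega), mul_zero]
      · rw [hodd_empty d h2, mul_zero]
  rw [hreindex]
  have hclass : ∀ s ∈ range (κ + 1),
      G (2 * s) * ∑ A ∈ univ.filter (fun A : Finset (Fin n) => (A.filter fun x => M.2.partner x ∈ A).card = 2 * s), p A =
      ((-1 : ℝ) ^ (κ - s) * (κ.choose s : ℝ) * knapsackMoment N r (2 * κ - s)) *
        ∑ T ∈ univ.filter (fun T : Finset (Fin n) => (T.filter fun x => M.2.partner x ∈ T).card = 2 * κ), p T := by
    intro s hs
    have hsκ : s ≤ κ := by have := mem_range.1 hs; omega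
    rw [pairedSum_eq_of_even hinv hfix hp hsκ]
    have hG : G (2 * s) = knapsackMoment N r (2 * κ - s) := by
      simp only [G]
      congr 1
      omega
    rw [hG]; ring
  rw [sum_congr rfl hclass, ← sum_mul]

/-! ### §3 The difference calculus of the knapsack moments and the virtual scalar in product form -/

/-- **Iterated forward differences of Grigoriev's knapsack moments**: for `x + j ≤ N`,
`(Δ^j K)(x) · Π_{i<j} (N − x − i) = K(x) · Π_{i<j} (r − N + i)`, `K = knapsackMoment N r` (from the one-step rule
`K(x+1) = K(x)(r−x)/(N−x)`). [cite: Grigoriev2001, Lemma 1.4 (PDF p. 8)] -/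
theorem fwdDiff_iter_knapsackMoment (N : ℕ) (r : ℝ) :
    ∀ j x : ℕ, x + j ≤ N →
      ((fwdDiff (1 : ℕ))^[j] (fun y : ℕ => knapsackMoment N r y)) x * ∏ i ∈ range j, ((N : ℝ) - x - i) =
        knapsackMoment N r x * ∏ i ∈ range j, (r - N + i) := by
  intro j
  induction j with
  | zero => intro x _; simp
  | succ j ih =>
    intro x hx
    have hNx : (N : ℝ) - x ≠ 0 := by
      have : (x : ℝ) < N := by exact_mod_cast (show x < N by omega)
      linarith
    have ih1 := ih (x + 1) (by omega)
    have ih0 := ih x (by omega)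
    have hQ : ∏ i ∈ range (j + 1), ((N : ℝ) - x - i) =
        ((N : ℝ) - x) * ∏ i ∈ range j, ((N : ℝ) - ((x + 1 : ℕ) : ℝ) - i) := by
      rw [prod_range_succ', mul_comm]
      congr 1
      · push_cast; ring
      · refine prod_congr rfl fun i _ => ?_
        push_cast; ring
    have hR : ∏ i ∈ range (j + 1), ((N : ℝ) - x - i) = (∏ i ∈ range j, ((N : ℝ) - x - i)) * ((N : ℝ) - x - j) :=
      prod_range_succ _ _
    have hK : knapsackMoment N r (x + 1) * ((N : ℝ) - x) = knapsackMoment N r x * (r - x) := by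
      rw [knapsackMoment_succ, mul_assoc, div_mul_cancel₀ _ hNx]
    rw [Function.iterate_succ_apply']
    show (((fwdDiff (1 : ℕ))^[j] fun y : ℕ => knapsackMoment N r y) (x + 1) - ((fwdDiff (1 : ℕ))^[j] fun y : ℕ => knapsackMoment N r y) x) *
        ∏ i ∈ range (j + 1), ((N : ℝ) - x - i) = knapsackMoment N r x * ∏ i ∈ range (j + 1), (r - N + i)
    calc (((fwdDiff (1 : ℕ))^[j] fun y : ℕ => knapsackMoment N r y) (x + 1) - ((fwdDiff (1 : ℕ))^[j] fun y : ℕ => knapsackMoment N r y) x) *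
          ∏ i ∈ range (j + 1), ((N : ℝ) - x - i)
        = (((fwdDiff (1 : ℕ))^[j] fun y : ℕ => knapsackMoment N r y) (x + 1) * ∏ i ∈ range j, ((N : ℝ) - ((x + 1 : ℕ) : ℝ) - i)) *
            ((N : ℝ) - x) -
          (((fwdDiff (1 : ℕ))^[j] fun y : ℕ => knapsackMoment N r y) x * ∏ i ∈ range j, ((N : ℝ) - x - i)) * ((N : ℝ) - x - j) := by
          rw [sub_mul]
          congr 1
          · rw [hQ]; ring
          · rw [hR]; ring
      _ = knapsackMoment N r (x + 1) * ((N : ℝ) - x) * ∏ i ∈ range j, (r - N + i) -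
          knapsackMoment N r x * ((N : ℝ) - x - j) * ∏ i ∈ range j, (r - N + i) := by rw [ih1, ih0]; ring
      _ = knapsackMoment N r x * ((∏ i ∈ range j, (r - N + i)) * (r - N + j)) := by rw [hK]; ring
      _ = knapsackMoment N r x * ∏ i ∈ range (j + 1), (r - N + i) := by rw [prod_range_succ]

/-- **The virtual scalar in product form** (Chu–Vandermonde for the knapsack moments): for `2κ ≤ N`,
`Σ_{s ≤ κ} (−1)^{κ−s} C(κ,s) K(2κ − s) = Π_{i<κ} (r−i)/(N−i) · Π_{i<κ} (N−r−i)/(N−κ−i)`. [cite: Grigoriev2001, Lemma 1.4 (PDF p. 8)] -/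
theorem altSum_knapsackMoment_eq (N κ : ℕ) (r : ℝ) (h : 2 * κ ≤ N) :
    ∑ s ∈ range (κ + 1), (-1 : ℝ) ^ (κ - s) * (κ.choose s : ℝ) * knapsackMoment N r (2 * κ - s) =
      (∏ i ∈ range κ, ((r - i) / ((N : ℝ) - i))) * ∏ i ∈ range κ, (((N : ℝ) - r - i) / ((N : ℝ) - κ - i)) := by
  -- the left side is `(−1)^κ (Δ^κ K)(κ)`
  have hΔ := fwdDiff_iter_eq_sum_shift (1 : ℕ) (fun y : ℕ => knapsackMoment N r y) κ κ
  have hreflect : ∑ s ∈ range (κ + 1), (-1 : ℝ) ^ (κ - s) * (κ.choose s : ℝ) * knapsackMoment N r (2 * κ - s) =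
      ∑ k ∈ range (κ + 1), (-1 : ℝ) ^ k * (κ.choose k : ℝ) * knapsackMoment N r (κ + k) := by
    rw [← sum_range_reflect (fun k => (-1 : ℝ) ^ k * (κ.choose k : ℝ) * knapsackMoment N r (κ + k)) (κ + 1)]
    refine sum_congr rfl fun s hs => ?_
    have hsκ : s ≤ κ := by have := mem_range.1 hs; omega
    simp only [add_tsub_cancel_right]
    rw [Nat.choose_symm hsκ]
    congr 2
    omega
  have hsum : ((fwdDiff (1 : ℕ))^[κ] (fun y : ℕ => knapsackMoment N r y)) κ =
      ∑ k ∈ range (κ + 1), (-1 : ℝ) ^ (κ - k) * (κ.choose k : ℝ) * knapsackMoment N r (κ + k) := by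
    rw [hΔ]
    refine sum_congr rfl fun k _ => ?_
    rw [zsmul_eq_mul]
    push_cast
    simp
  have hsign : ∑ k ∈ range (κ + 1), (-1 : ℝ) ^ k * (κ.choose k : ℝ) * knapsackMoment N r (κ + k) =
      (-1 : ℝ) ^ κ * ∑ k ∈ range (κ + 1), (-1 : ℝ) ^ (κ - k) * (κ.choose k : ℝ) * knapsackMoment N r (κ + k) := by
    rw [mul_sum]
    refine sum_congr rfl fun k hk => ?_
    have hkκ : k ≤ κ := by have := mem_range.1 hk; omega
    have hpow : (-1 : ℝ) ^ k = (-1 : ℝ) ^ κ * (-1 : ℝ) ^ (κ - k) := by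
      have h1 : (-1 : ℝ) ^ κ = (-1 : ℝ) ^ k * (-1 : ℝ) ^ (κ - k) := by rw [← pow_add, Nat.add_sub_cancel' hkκ]
      have h2 : (-1 : ℝ) ^ (κ - k) * (-1 : ℝ) ^ (κ - k) = 1 := by
        rw [← pow_add, ← two_mul, pow_mul]; simp
      calc (-1 : ℝ) ^ k = (-1 : ℝ) ^ k * ((-1 : ℝ) ^ (κ - k) * (-1 : ℝ) ^ (κ - k)) := by rw [h2, mul_one]
        _ = (-1 : ℝ) ^ κ * (-1 : ℝ) ^ (κ - k) := by rw [h1]; ring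
    rw [hpow]; ring
  -- the closed form of `Δ^κ K` at `κ`
  have hclosed := fwdDiff_iter_knapsackMoment N r κ κ (by omega)
  have hden : ∏ i ∈ range κ, ((N : ℝ) - κ - i) ≠ 0 := by
    refine prod_ne_zero_iff.2 fun i hi => ?_
    have hi' := mem_range.1 hi
    have : ((κ : ℝ) + i) < N := by exact_mod_cast (show κ + i < N by omega)
    linarith
  have hΔval : ((fwdDiff (1 : ℕ))^[κ] (fun y : ℕ => knapsackMoment N r y)) κ =
      knapsackMoment N r κ * (∏ i ∈ range κ, (r - N + i)) / ∏ i ∈ range κ, ((N : ℝ) - κ - i) := by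
    rw [eq_div_iff hden, hclosed]
  rw [hreflect, hsign, ← hsum, hΔval]
  -- `K(κ) = Π (r−i)/(N−i)` and `(−1)^κ Π (r − N + i) = Π (N − r − i)`
  have hK : knapsackMoment N r κ = ∏ i ∈ range κ, ((r - i) / ((N : ℝ) - i)) := rfl
  have hneg : (-1 : ℝ) ^ κ * ∏ i ∈ range κ, (r - N + i) = ∏ i ∈ range κ, ((N : ℝ) - r - i) := by
    rw [show (-1 : ℝ) ^ κ = ∏ _i ∈ range κ, (-1 : ℝ) by simp, ← prod_mul_distrib]
    exact prod_congr rfl fun i _ => by ring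
  rw [hK, prod_div_distrib, prod_div_distrib, ← hneg]
  ring

/-- **The virtual scalar at `N = n/2`, `r = t/2`, `t = 2a+1`** (`n` even, `4κ ≤ n`):
`Π_{i<κ} (r−i)/(N−i) · Π_{i<κ} (N−r−i)/(N−κ−i) = Π_{i<κ} (2a+1−2i)/(n−2i) · Π_{i<κ} (n−2a−1−2i)/(n−2κ−2i)`.
[cite: Grigoriev2001, Lemma 1.4 (PDF p. 8)] -/
theorem virtualScalar_eq_prod {a κ : ℕ} (hn : Even n) (hκn : 4 * κ ≤ n) :
    (∏ i ∈ range κ, (((((2 * a + 1 : ℕ) : ℝ) / 2) - i) / (((n / 2 : ℕ) : ℝ) - i))) *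
        ∏ i ∈ range κ, ((((n / 2 : ℕ) : ℝ) - (((2 * a + 1 : ℕ) : ℝ) / 2) - i) / (((n / 2 : ℕ) : ℝ) - κ - i)) =
      (∏ i ∈ range κ, (((2 * a + 1 : ℝ) - 2 * i) / ((n : ℝ) - 2 * i))) *
        ∏ i ∈ range κ, (((n : ℝ) - 2 * a - 1 - 2 * i) / ((n : ℝ) - 2 * κ - 2 * i)) := by
  obtain ⟨m, hm⟩ := hn
  have hm2 : n / 2 = m := by omega
  have hmR : ((n / 2 : ℕ) : ℝ) = (n : ℝ) / 2 := by
    rw [hm2]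
    have h : (n : ℝ) = m + m := by exact_mod_cast hm
    rw [h]; ring
  rw [hmR]
  congr 1
  · refine prod_congr rfl fun i hi => ?_
    have hi' := mem_range.1 hi
    have hd : (n : ℝ) - 2 * i ≠ 0 := by
      have : (2 * i : ℝ) < n := by exact_mod_cast (show 2 * i < n by omega)
      linarith
    have hd' : (n : ℝ) / 2 - i ≠ 0 := by
      intro h; apply hd; linarith
    rw [div_eq_div_iff hd' hd]
    push_cast
    ring
  · refine prod_congr rfl fun i hi => ?_
    have hi' := mem_range.1 hi
    have hd : (n : ℝ) - 2 * κ - 2 * i ≠ 0 := by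
      have : (2 * κ + 2 * i : ℝ) < n := by exact_mod_cast (show 2 * κ + 2 * i < n by omega)
      linarith
    have hd' : (n : ℝ) / 2 - κ - i ≠ 0 := by
      intro h; apply hd; linarith
    rw [div_eq_div_iff hd' hd]
    push_cast
    ring

end Summit.PneNP.PneNP.Theorems.ChebyshevTracialDesignVirtualLayerFunctional
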